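import Mathlib
import HarnessLib
import Summits.KontsevichZagierPeriods.KontsevichZagierPeriods.Theorems.FurushoPentagonKernelModuloPeriodConjectureEvenDepthOneLeaf

/-!
# `KernelModuloPeriodConjecture`, line `Sketch`: the algebraic leaf on the repeated even letters

Crux `FurushoPentagon.KernelModuloPeriodConjecture` (stmt-KontsevichZagierPeriods-15058), line
`Sketch`, registered stub `stub_replicateEvenLeaf` (stub (vi) of the lead's skeleton). For every
`c ≥ 1` and `m ≥ 1` there is ONE rational `r` with
`c_{binaryWord {2c}ᵐ}(φ) = r · c_{binaryWord {2}^{cm}}(φ)` at every group-like solution `φ` of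
Drinfeld's pentagon equation over every commutative `ℚ`-algebra: Hoffman's theorem
`ζ(2c, …, 2c) ∈ ℚ π^{2cm} = ℚ ζ(2, …, 2)` ([Hoffman1992, Theorem 2.2 and Corollary 2.3]) for
associators, i.e. the repeated even letter `{2c}ᵐ` reduces to the single Hoffman word `{2}^{cm}`.

The statement takes as hypothesis the neighbouring stub `stub_powerFormReplicate` (power form on the
repeated even letters): for every `c ≥ 1`, up to every `N`, ONE rational sequence `q` with
`π_Y(φ)({2c}ʲ) = q_j c_{(2)}(φ)^{cj}` (`j ≤ N`). Proof: at `(c, N := m)` it gives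
`π_Y(φ)({2c}ᵐ) = q'_m c_{(2)}^{cm}`; at `(1, N := cm)` it gives `π_Y(φ)({2}^{cm}) = q_{cm} c_{(2)}^{cm}`
with `q_{cm} ≠ 0` by evaluation at the real Drinfeld associator (`evenLeaf_q_ne_zero`); and
`π_Y(φ)(s) = (-1)^{|s|} c_{binaryWord s}(φ)` on lists of positive integers
(`NCSeries.piY_apply_of_forall_pos`), so `r = (-1)ᵐ q'_m q_{cm}⁻¹ (-1)^{cm}`.

References: M. E. Hoffman, *Multiple harmonic series*, Pacific J. Math. 152 (1992), Thm 2.2,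
Cor. 2.3 [Hoffman1992]; H. Furusho, *Double shuffle relation for associators*, Ann. of Math. 174
(2011), §2 [Furusho2011].
-/

namespace Summit.KontsevichZagierPeriods.FurushoPentagon.KernelModuloPeriodConjecture

open Literature.NumberTheory.Transcendental

/-- The entries of the repeated even letter `{2c}ᵐ` are positive when `c ≥ 1` (so `{2c}ᵐ` is a
`Y`-word for Furusho's `π_Y`). [folklore] -/
theorem replicateEven_forall_pos {c : ℕ} (hc : 1 ≤ c) (m : ℕ) :
    ∀ i ∈ List.replicate m (2 * c), 1 ≤ i := fun i hi => by
  rw [List.eq_of_mem_replicate hi]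
  omega

/-- `((-1)ᵐ)² = 1` in any commutative ring: `x = (-1)ᵐ ((-1)ᵐ x)`. [folklore] -/
theorem replicateEven_neg_one_pow_mul_self_mul {R : Type} [CommRing R] (m : ℕ) (x : R) :
    (-1 : R) ^ m * ((-1) ^ m * x) = x := by
  rw [← mul_assoc, ← mul_pow, neg_mul_neg, one_mul, one_pow, one_mul]

/-- **Registered stub `stub_replicateEvenLeaf`** (stub (vi) of the lead's skeleton, crux
stmt-KontsevichZagierPeriods-15058, line `Sketch`), verbatim: from the power form on the repeated even
letters (neighbouring stub `stub_powerFormReplicate`, taken as hypothesis), for every `c ≥ 1`, `m ≥ 1`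
ONE rational `r` with `c_{({2c}ᵐ)}(φ) = r • c_{({2}^{cm})}(φ)` at every group-like solution of
Drinfeld's pentagon over every commutative `ℚ`-algebra — Hoffman's theorem
`ζ(2c, …, 2c) ∈ ℚ ζ(2, …, 2)` for associators (`r = (-1)ᵐ q'_m q_{cm}⁻¹ (-1)^{cm}` with
`π_Y(φ)({2c}ᵐ) = q'_m c_{(2)}^{cm}`, `π_Y(φ)({2}^{cm}) = q_{cm} c_{(2)}^{cm}`, `q_{cm} ≠ 0` at `Φ_KZ`).
[cite: Hoffman1992, Theorem 2.2] -/
theorem stub_replicateEvenLeaf :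
    (∀ c : ℕ, 1 ≤ c → ∀ N : ℕ, ∃ q : ℕ → ℚ, ∀ j : ℕ, j ≤ N →
      ∀ (R : Type) [CommRing R] [Algebra ℚ R] (φ : NCSeries Bool R),
        NCSeries.IsGroupLike φ → NCSeries.DrinfeldPentagon φ →
          NCSeries.piY φ (List.replicate j (2 * c)) =
            algebraMap ℚ R (q j) * φ (MZV.binaryWord [2]) ^ (c * j)) →
    ∀ c m : ℕ, 1 ≤ c → 1 ≤ m → ∃ r : ℚ, ∀ (R : Type) [CommRing R] [Algebra ℚ R] (φ : NCSeries Bool R),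
      NCSeries.IsGroupLike φ → NCSeries.DrinfeldPentagon φ →
        φ (MZV.binaryWord (List.replicate m (2 * c))) = r • φ (MZV.binaryWord (List.replicate (c * m) 2)) := by
  intro hP c m hc _hm
  -- power form on `{2c}ʲ`, `j ≤ m`
  obtain ⟨q', hq'⟩ := hP c hc m
  -- power form on `{2}ʲ = {2·1}ʲ`, `j ≤ c m`, normalised (`2 * 1 = 2`, `1 * j = j`)
  obtain ⟨q, hq⟩ := hP 1 le_rfl (c * m)
  have hq1 : ∀ j : ℕ, j ≤ c * m → ∀ (R : Type) [CommRing R] [Algebra ℚ R] (φ : NCSeries Bool R),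
      NCSeries.IsGroupLike φ → NCSeries.DrinfeldPentagon φ →
        NCSeries.piY φ (List.replicate j 2) = algebraMap ℚ R (q j) * φ (MZV.binaryWord [2]) ^ j := by
    intro j hj R _ _ φ hg h5
    simpa only [Nat.mul_one, Nat.one_mul] using hq j hj R φ hg h5
  have hqn : q (c * m) ≠ 0 := evenLeaf_q_ne_zero (hq1 (c * m) le_rfl)
  refine ⟨(-1) ^ m * q' m * ((q (c * m))⁻¹ * (-1) ^ (c * m)), fun R _ _ φ hg h5 => ?_⟩
  have h1 := hq' m le_rfl R φ hg h5
  rw [NCSeries.piY_apply_of_forall_pos φ (replicateEven_forall_pos hc m),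
    List.length_replicate] at h1
  have h2 := hq1 (c * m) le_rfl R φ hg h5
  rw [NCSeries.piY_apply_of_forall_pos φ (MZV.isAdmissible_replicate_two (c * m)).1,
    List.length_replicate] at h2
  have h3 := evenLeaf_eq_inv_mul hqn h2.symm
  have h4 : φ (MZV.binaryWord (List.replicate m (2 * c))) =
      (-1) ^ m * (algebraMap ℚ R (q' m) * φ (MZV.binaryWord [2]) ^ (c * m)) := by
    rw [← h1, replicateEven_neg_one_pow_mul_self_mul]
  rw [h4, h3, Algebra.smul_def]
  simp only [map_mul, map_pow, map_neg, map_one]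
  ring

end Summit.KontsevichZagierPeriods.FurushoPentagon.KernelModuloPeriodConjecture
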